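import Summits.QuantumFields.YangMills.Theorems.UnitScaleTiltProp7Lane2CutoffFamilyRows
import Literature.MathematicalPhysics.QuantumFieldTheory.Balaban1983to89.B9Eq3132TentFlat
import HarnessLib

/-!
# Route `UnitScaleTilt`, crux «MinimiserStabilityRegPr» (stmt-QuantumFields-19200), E′ ∕ (N06) LANE II «DIVERGENCE RECOVERY AT CURVED `W`» — brick (B6), the SUMMED Laplacian-commutator row:
# `c₀·Σ_x hs(η⁻²·Σ_c Σ_μ[(ζ_c(x)−ζ_c(x−e_μ))D*_μλ_c − (ζ_c(x+e_μ)−ζ_c(x))D_μλ_c − (∂²_μζ_c)λ_c](x)) ≤ 36k·a²·η⁻²·Σ_c‖D_Wλ̃_c‖² + 81k·a₂²·η⁻⁴·Σ_c‖λ̃_c‖²`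

Cell `ym3-torus`, width seat `ym3-torus-px11` (gen 6); continuation of ✓∕⧗ `…Lane2CutoffFamilyRows` (§4 of its plan) for ★p1 g19's (B7-CORE) slot `‖Σ_i [Δ, Z_i]φ_i‖²` (:225 of SIGNATURE 80078390).
THEOREMS ONLY (0 `def`, 0 `sorry`); `--supports stmt-QuantumFields-19200`, count-neutral.  YM₃ on T³ is a ladder rung (R3), not the Clay problem; nothing here claims (B7), (REC), `hN06`,
a stub, the crux, d = 4 or the mass gap.

MECHANISM (as in the sibling): the bracket of ✓ `Prop7ConjFrameTransport.divB_covD_smul_fun` summed over the family is, per site and direction, three weighted sums `Σ_c w_c•X_c` with weights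
= first ∕ second differences of the `ζ_c`; entrywise weighted Cauchy–Schwarz (✓ `hs_sum_smul_le`) and the alive-count bounds `Σ_c|w_c| ≤ 2k·a` ∕ `3k·a₂` (✓ `sum_abs_sub_le_of_alive`,
✓ `sum_abs_second_le_of_alive`) give family sums of `hs(D*_μλ_c)`, `hs(D_μλ_c)`, `hs(λ_c)`; `hs(D*_μλ(x)) = hs(D_μλ(x−e_μ))` (unitarity) and a shift of the site sum finish.
* §1 `hs_weighted_le` — `hs(Σ_c w_c•X_c) ≤ Wt·a·Σ_c hs(X_c)` when `Σ|w_c| ≤ Wt`, `|w_c| ≤ a`; `hs_sub_sub_le` (`hs(A − B − C) ≤ 3(…)`); `card_dir_eq_three` (the site-sum shift is lit ✓`B9Eq3132TentFlat.sum_unshift`).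
* §2 ★ `hs_lapComm_point_le` — the pointwise bound at a site.
* §3 ★★ `hs_sum_lap_comm_le` — the summed row in (B7-CORE)'s currency (function side; the member-level `Z i` packaging is `…Lane2CutoffPackage`).

References: T. Bałaban, CMP 99 (1985) 389–434 [Balaban1985BackgroundPropagators] ((3.100) pp.413–414, (3.23) p.394); CMP 96 (1984) 223–250 [Balaban1984PropagatorsII] (p.238).
-/

set_option autoImplicit false

noncomputable section

open scoped BigOperators Matrix.Norms.L2Operator Matrix

namespace Summit.QuantumFields.YangMills.Theorems.Prop7Lane2CutoffFamilyRows

open Literature.MathematicalPhysics.QuantumFieldTheory.Balaban1983to89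
open Literature.MathematicalPhysics.QuantumFieldTheory.Balaban1983to89.T3ContinuumYM3Torus
open T3SectALandauChart (bgUnits eta eta_pos)
open B9Eq39Adjoint (R covD covDstar divB)
open B9TorusCalculus (torusT torusT_apply torusT_symm_apply)
open B10StarCount (shift_unshift unshift_shift)
open Summit.QuantumFields.YangMills.Theorems.Prop7CovAgmonLetters (hs_smul hs_sum_le hs_add₃_le hs_neg hs_covDstar_eq)
open B9Eq3132TentFlat (sum_unshift)
open Summit.QuantumFields.YangMills.Theorems.Prop7Lane2CutoffCommutators (coe_bgUnits_mem_unitary)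
open Finset

/-! ## §1 Letters -/

section Letters

variable {ι : Type*} {N : ℕ}

/-- `hs(Σ_c w_c•X_c) ≤ Wt·a·Σ_c hs(X_c)` when `Σ_c |w_c| ≤ Wt` and `|w_c| ≤ a`. [folklore] -/
theorem hs_weighted_le (s : Finset ι) (w : ι → ℝ) (X : ι → Matrix (Fin N) (Fin N) ℂ) {Wt a : ℝ}
    (hWt : ∑ c ∈ s, |w c| ≤ Wt) (ha : ∀ c ∈ s, |w c| ≤ a) :
    ∑ j : Fin N, ∑ k : Fin N, ‖(∑ c ∈ s, w c • X c) j k‖ ^ 2 ≤ Wt * a * ∑ c ∈ s, ∑ j : Fin N, ∑ k : Fin N, ‖X c j k‖ ^ 2 := by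
  have hhs : ∀ c ∈ s, 0 ≤ ∑ j : Fin N, ∑ k : Fin N, ‖X c j k‖ ^ 2 := fun c _ => Finset.sum_nonneg fun _ _ => Finset.sum_nonneg fun _ _ => sq_nonneg _
  have h1 := hs_sum_smul_le s w X
  have h2 := sum_weight_mul_le s w (fun c => ∑ j : Fin N, ∑ k : Fin N, ‖X c j k‖ ^ 2) ha hhs
  have h0 : 0 ≤ ∑ c ∈ s, |w c| := Finset.sum_nonneg fun _ _ => abs_nonneg _
  have h0' : 0 ≤ ∑ c ∈ s, |w c| * ∑ j : Fin N, ∑ k : Fin N, ‖X c j k‖ ^ 2 := Finset.sum_nonneg fun c hc => mul_nonneg (abs_nonneg _) (hhs c hc)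
  have hWt0 : 0 ≤ Wt := h0.trans hWt
  calc _ ≤ (∑ c ∈ s, |w c|) * ∑ c ∈ s, |w c| * ∑ j : Fin N, ∑ k : Fin N, ‖X c j k‖ ^ 2 := h1
    _ ≤ Wt * (a * ∑ c ∈ s, ∑ j : Fin N, ∑ k : Fin N, ‖X c j k‖ ^ 2) := mul_le_mul hWt h2 h0' hWt0
    _ = _ := by ring

/-- `hs(A − B − C) ≤ 3(hs A + hs B + hs C)`. [folklore] -/
theorem hs_sub_sub_le (A B C : Matrix (Fin N) (Fin N) ℂ) :
    ∑ j : Fin N, ∑ k : Fin N, ‖(A - B - C) j k‖ ^ 2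
      ≤ 3 * (∑ j : Fin N, ∑ k : Fin N, ‖A j k‖ ^ 2 + ∑ j : Fin N, ∑ k : Fin N, ‖B j k‖ ^ 2 + ∑ j : Fin N, ∑ k : Fin N, ‖C j k‖ ^ 2) := by
  have h := hs_add₃_le A (-B) (-C)
  rw [hs_neg, hs_neg] at h
  have e : A - B - C = A + -B + -C := by abel
  rw [e]; exact h

end Letters

/-! ## §2 ★ The pointwise bound (member letters, `N = 2`) -/

section Point

variable (F : T3Family) (K : ℕ) (U : Fin (F.P K).d → Site (F.P K) 0 → (Matrix (Fin 2) (Fin 2) ℂ)ˣ)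
variable {ι : Type*} [Fintype ι] [DecidableEq ι] (ζ : ι → Site (F.P K) 0 → ℝ) (l : ι → Site (F.P K) 0 → Matrix (Fin 2) (Fin 2) ℂ)

/-- `(F.P K).d = 3` as a real number. [folklore] -/
theorem card_dir_eq_three : (Fintype.card (Fin (F.P K).d) : ℝ) = 3 := by
  rw [Fintype.card_fin]; show ((3 : ℕ) : ℝ) = 3; norm_num

/-- ★ **POINTWISE**: at a site `x`, the hs of the family-summed bracket `Σ_c Σ_μ[(ζ_c(x)−ζ_c(x−e_μ))•D*_μλ_c(x) − (ζ_c(x+e_μ)−ζ_c(x))•D_μλ_c(x) − (∂²_μζ_c(x))•λ_c(x)]` is at most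
`9·Σ_μ[2k·a²·Σ_c hs(D*_μλ_c(x)) + 2k·a²·Σ_c hs(D_μλ_c(x)) + 3k·a₂²·Σ_c hs(λ_c(x))]`. [cite: Balaban1985BackgroundPropagators, (3.100) pp.413–414] -/
theorem hs_lapComm_point_le {k : ℕ} {a a₂ : ℝ} (ha : 0 ≤ a) (ha₂ : 0 ≤ a₂)
    (hk : ∀ y : Site (F.P K) 0, (Finset.univ.filter fun c : ι => ζ c y ≠ 0).card ≤ k)
    (hstep : ∀ c (x : Site (F.P K) 0) (μ : Fin (F.P K).d), |ζ c (x.shift μ) - ζ c x| ≤ a ∧ |ζ c (x.unshift μ) - ζ c x| ≤ a)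
    (hsec : ∀ c (x : Site (F.P K) 0) (μ : Fin (F.P K).d), |ζ c (x.shift μ) + ζ c (x.unshift μ) - 2 * ζ c x| ≤ a₂) (x : Site (F.P K) 0) :
    ∑ j : Fin 2, ∑ k' : Fin 2, ‖(∑ c : ι, ∑ μ : Fin (F.P K).d,
        ((ζ c x - ζ c (x.unshift μ)) • covDstar (torusT (F.P K) 0) U μ (l c) x
          - (ζ c (x.shift μ) - ζ c x) • covD (torusT (F.P K) 0) U μ (l c) x
          - ((ζ c (x.shift μ) - ζ c x) - (ζ c x - ζ c (x.unshift μ))) • l c x)) j k'‖ ^ 2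
      ≤ 9 * ∑ μ : Fin (F.P K).d, (2 * k * a ^ 2 * ∑ c : ι, ∑ j : Fin 2, ∑ k' : Fin 2, ‖(covDstar (torusT (F.P K) 0) U μ (l c) x) j k'‖ ^ 2
          + 2 * k * a ^ 2 * ∑ c : ι, ∑ j : Fin 2, ∑ k' : Fin 2, ‖(covD (torusT (F.P K) 0) U μ (l c) x) j k'‖ ^ 2
          + 3 * k * a₂ ^ 2 * ∑ c : ι, ∑ j : Fin 2, ∑ k' : Fin 2, ‖l c x j k'‖ ^ 2) := by
  -- reorganise: `Σ_c Σ_μ (t1 − t2 − t3) = Σ_μ (A_μ − B_μ − C_μ)`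
  have hsplit : ∀ μ : Fin (F.P K).d, ∑ c : ι, ((ζ c x - ζ c (x.unshift μ)) • covDstar (torusT (F.P K) 0) U μ (l c) x
        - (ζ c (x.shift μ) - ζ c x) • covD (torusT (F.P K) 0) U μ (l c) x
        - ((ζ c (x.shift μ) - ζ c x) - (ζ c x - ζ c (x.unshift μ))) • l c x)
      = (∑ c : ι, (ζ c x - ζ c (x.unshift μ)) • covDstar (torusT (F.P K) 0) U μ (l c) x)
        - (∑ c : ι, (ζ c (x.shift μ) - ζ c x) • covD (torusT (F.P K) 0) U μ (l c) x)
        - (∑ c : ι, ((ζ c (x.shift μ) - ζ c x) - (ζ c x - ζ c (x.unshift μ))) • l c x) := fun μ => by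
    rw [← Finset.sum_sub_distrib, ← Finset.sum_sub_distrib]
  have hswap : (∑ c : ι, ∑ μ : Fin (F.P K).d, ((ζ c x - ζ c (x.unshift μ)) • covDstar (torusT (F.P K) 0) U μ (l c) x
        - (ζ c (x.shift μ) - ζ c x) • covD (torusT (F.P K) 0) U μ (l c) x
        - ((ζ c (x.shift μ) - ζ c x) - (ζ c x - ζ c (x.unshift μ))) • l c x))
      = ∑ μ : Fin (F.P K).d, ((∑ c : ι, (ζ c x - ζ c (x.unshift μ)) • covDstar (torusT (F.P K) 0) U μ (l c) x)
        - (∑ c : ι, (ζ c (x.shift μ) - ζ c x) • covD (torusT (F.P K) 0) U μ (l c) x)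
        - (∑ c : ι, ((ζ c (x.shift μ) - ζ c x) - (ζ c x - ζ c (x.unshift μ))) • l c x)) := by
    rw [Finset.sum_comm]
    exact Finset.sum_congr rfl fun μ _ => hsplit μ
  rw [hswap]
  -- `hs(Σ_μ Z_μ) ≤ 3·Σ_μ hs(Z_μ)`
  have hZ := hs_sum_le (N := 2) (Finset.univ : Finset (Fin (F.P K).d))
    (fun μ => (∑ c : ι, (ζ c x - ζ c (x.unshift μ)) • covDstar (torusT (F.P K) 0) U μ (l c) x)
        - (∑ c : ι, (ζ c (x.shift μ) - ζ c x) • covD (torusT (F.P K) 0) U μ (l c) x)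
        - (∑ c : ι, ((ζ c (x.shift μ) - ζ c x) - (ζ c x - ζ c (x.unshift μ))) • l c x))
  rw [Finset.card_univ, card_dir_eq_three] at hZ
  refine hZ.trans ?_
  rw [Finset.mul_sum, Finset.mul_sum]
  refine Finset.sum_le_sum fun μ _ => ?_
  -- per direction: `hs(A − B − C) ≤ 3(hs A + hs B + hs C)` and the three weighted Cauchy–Schwarz bounds
  refine (mul_le_mul_of_nonneg_left (hs_sub_sub_le _ _ _) (by norm_num : (0:ℝ) ≤ 3)).trans ?_
  have hA : ∑ j : Fin 2, ∑ k' : Fin 2, ‖(∑ c : ι, (ζ c x - ζ c (x.unshift μ)) • covDstar (torusT (F.P K) 0) U μ (l c) x) j k'‖ ^ 2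
      ≤ 2 * k * a * a * ∑ c : ι, ∑ j : Fin 2, ∑ k' : Fin 2, ‖(covDstar (torusT (F.P K) 0) U μ (l c) x) j k'‖ ^ 2 := by
    have hst : ∀ c : ι, |ζ c x - ζ c (x.unshift μ)| ≤ a := fun c => by rw [abs_sub_comm]; exact (hstep c x μ).2
    refine hs_weighted_le Finset.univ (fun c => ζ c x - ζ c (x.unshift μ)) _ ?_ (fun c _ => hst c)
    exact sum_abs_sub_le_of_alive ζ (x.unshift μ) x ha hk hst
  have hB : ∑ j : Fin 2, ∑ k' : Fin 2, ‖(∑ c : ι, (ζ c (x.shift μ) - ζ c x) • covD (torusT (F.P K) 0) U μ (l c) x) j k'‖ ^ 2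
      ≤ 2 * k * a * a * ∑ c : ι, ∑ j : Fin 2, ∑ k' : Fin 2, ‖(covD (torusT (F.P K) 0) U μ (l c) x) j k'‖ ^ 2 := by
    have hst : ∀ c : ι, |ζ c (x.shift μ) - ζ c x| ≤ a := fun c => (hstep c x μ).1
    refine hs_weighted_le Finset.univ (fun c => ζ c (x.shift μ) - ζ c x) _ ?_ (fun c _ => hst c)
    exact sum_abs_sub_le_of_alive ζ x (x.shift μ) ha hk hst
  have hC : ∑ j : Fin 2, ∑ k' : Fin 2, ‖(∑ c : ι, ((ζ c (x.shift μ) - ζ c x) - (ζ c x - ζ c (x.unshift μ))) • l c x) j k'‖ ^ 2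
      ≤ 3 * k * a₂ * a₂ * ∑ c : ι, ∑ j : Fin 2, ∑ k' : Fin 2, ‖l c x j k'‖ ^ 2 := by
    have e : ∀ c : ι, (ζ c (x.shift μ) - ζ c x) - (ζ c x - ζ c (x.unshift μ)) = ζ c (x.shift μ) + ζ c (x.unshift μ) - 2 * ζ c x := fun c => by ring
    simp only [e]
    refine hs_weighted_le Finset.univ (fun c => ζ c (x.shift μ) + ζ c (x.unshift μ) - 2 * ζ c x) _ ?_ (fun c _ => hsec c x μ)
    exact sum_abs_second_le_of_alive ζ x (x.shift μ) (x.unshift μ) ha₂ hk (fun c => hsec c x μ)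
  nlinarith [hA, hB, hC]

end Point

/-! ## §3 ★★ The summed row -/

section Summed

variable (F : T3Family) (n K : ℕ) (c₀ : ℝ) [Fact (0 < c₀)] (W : GaugeField (F.P K) 0 (Matrix.specialUnitaryGroup (Fin 2) ℂ))
variable {ι : Type*} [Fintype ι] [DecidableEq ι] (ζ : ι → Site (F.P K) 0 → ℝ) (l : ι → Site (F.P K) 0 → Matrix (Fin 2) (Fin 2) ℂ)

/-- ★★ **ROW 2, SUMMED** (function side, (B7-CORE)'s currency): with at most `k` cutoffs alive per site, steps `≤ a`, second differences `≤ a₂`: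
`c₀·Σ_x hs((η⁻¹)²•Σ_cΣ_μ[…](x)) ≤ 36k·a²·η⁻²·Σ_c (c₀·η⁻²·Σ_xΣ_μ hs(D_μλ_c(x))) + 81k·a₂²·η⁻⁴·Σ_c (c₀·Σ_x hs(λ_c(x)))` — the two family sums are `Σ_c‖D_Wλ̃_c‖²` and `Σ_c‖λ̃_c‖²`.
[cite: Balaban1985BackgroundPropagators, (3.100) pp.413–414, (3.23) p.394] -/
theorem hs_sum_lap_comm_le {k : ℕ} {a a₂ : ℝ} (ha : 0 ≤ a) (ha₂ : 0 ≤ a₂)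
    (hk : ∀ y : Site (F.P K) 0, (Finset.univ.filter fun c : ι => ζ c y ≠ 0).card ≤ k)
    (hstep : ∀ c (x : Site (F.P K) 0) (μ : Fin (F.P K).d), |ζ c (x.shift μ) - ζ c x| ≤ a ∧ |ζ c (x.unshift μ) - ζ c x| ≤ a)
    (hsec : ∀ c (x : Site (F.P K) 0) (μ : Fin (F.P K).d), |ζ c (x.shift μ) + ζ c (x.unshift μ) - 2 * ζ c x| ≤ a₂) :
    c₀ * ∑ x : Site (F.P K) 0, ∑ j : Fin 2, ∑ k' : Fin 2, ‖((((eta F n K)⁻¹) ^ 2) • ∑ c : ι, ∑ μ : Fin (F.P K).d,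
        ((ζ c x - ζ c (x.unshift μ)) • covDstar (torusT (F.P K) 0) (fun μ z => bgUnits F K W ⟨z, μ⟩) μ (l c) x
          - (ζ c (x.shift μ) - ζ c x) • covD (torusT (F.P K) 0) (fun μ z => bgUnits F K W ⟨z, μ⟩) μ (l c) x
          - ((ζ c (x.shift μ) - ζ c x) - (ζ c x - ζ c (x.unshift μ))) • l c x)) j k'‖ ^ 2
      ≤ 36 * k * a ^ 2 * ((eta F n K)⁻¹) ^ 2 *
            ∑ c : ι, (c₀ * ((eta F n K)⁻¹) ^ 2 * ∑ x : Site (F.P K) 0, ∑ μ : Fin (F.P K).d, ∑ j : Fin 2, ∑ k' : Fin 2,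
              ‖(covD (torusT (F.P K) 0) (fun μ z => bgUnits F K W ⟨z, μ⟩) μ (l c) x) j k'‖ ^ 2)
        + 81 * k * a₂ ^ 2 * (((eta F n K)⁻¹) ^ 2) ^ 2 * ∑ c : ι, (c₀ * ∑ x : Site (F.P K) 0, ∑ j : Fin 2, ∑ k' : Fin 2, ‖l c x j k'‖ ^ 2) := by
  have hc : (0 : ℝ) < c₀ := Fact.out
  set U : Fin (F.P K).d → Site (F.P K) 0 → (Matrix (Fin 2) (Fin 2) ℂ)ˣ := fun μ z => bgUnits F K W ⟨z, μ⟩ with hU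
  have hUu : ∀ ν z, (U ν z : Matrix (Fin 2) (Fin 2) ℂ) ∈ unitary (Matrix (Fin 2) (Fin 2) ℂ) := fun ν z => coe_bgUnits_mem_unitary F K W ν z
  -- abbreviations for the three pointwise family sums
  set A : Site (F.P K) 0 → Fin (F.P K).d → ℝ := fun x μ => ∑ c : ι, ∑ j : Fin 2, ∑ k' : Fin 2, ‖(covDstar (torusT (F.P K) 0) U μ (l c) x) j k'‖ ^ 2 with hA
  set B : Site (F.P K) 0 → Fin (F.P K).d → ℝ := fun x μ => ∑ c : ι, ∑ j : Fin 2, ∑ k' : Fin 2, ‖(covD (torusT (F.P K) 0) U μ (l c) x) j k'‖ ^ 2 with hB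
  set C : Site (F.P K) 0 → ℝ := fun x => ∑ c : ι, ∑ j : Fin 2, ∑ k' : Fin 2, ‖l c x j k'‖ ^ 2 with hC
  -- pointwise, with the `η⁻⁴` pulled out and the constants distributed
  have hpt : ∀ x : Site (F.P K) 0, ∑ j : Fin 2, ∑ k' : Fin 2, ‖((((eta F n K)⁻¹) ^ 2) • ∑ c : ι, ∑ μ : Fin (F.P K).d,
        ((ζ c x - ζ c (x.unshift μ)) • covDstar (torusT (F.P K) 0) U μ (l c) x
          - (ζ c (x.shift μ) - ζ c x) • covD (torusT (F.P K) 0) U μ (l c) x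
          - ((ζ c (x.shift μ) - ζ c x) - (ζ c x - ζ c (x.unshift μ))) • l c x)) j k'‖ ^ 2
      ≤ ∑ μ : Fin (F.P K).d, ((((eta F n K)⁻¹) ^ 2) ^ 2 * 9 * (2 * k * a ^ 2) * A x μ
          + (((eta F n K)⁻¹) ^ 2) ^ 2 * 9 * (2 * k * a ^ 2) * B x μ + (((eta F n K)⁻¹) ^ 2) ^ 2 * 9 * (3 * k * a₂ ^ 2) * C x) := by
    intro x
    rw [hs_smul]
    refine (mul_le_mul_of_nonneg_left (hs_lapComm_point_le F K U ζ l ha ha₂ hk hstep hsec x) (sq_nonneg _)).trans (le_of_eq ?_)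
    rw [Finset.mul_sum, Finset.mul_sum]
    exact Finset.sum_congr rfl fun μ _ => by ring
  have hsum := Finset.sum_le_sum fun x (_ : x ∈ (Finset.univ : Finset (Site (F.P K) 0))) => hpt x
  -- split the summed right-hand side into the three global family sums
  have hsplit : ∑ x : Site (F.P K) 0, ∑ μ : Fin (F.P K).d, ((((eta F n K)⁻¹) ^ 2) ^ 2 * 9 * (2 * k * a ^ 2) * A x μ
          + (((eta F n K)⁻¹) ^ 2) ^ 2 * 9 * (2 * k * a ^ 2) * B x μ + (((eta F n K)⁻¹) ^ 2) ^ 2 * 9 * (3 * k * a₂ ^ 2) * C x)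
      = (((eta F n K)⁻¹) ^ 2) ^ 2 * 9 * (2 * k * a ^ 2) * ∑ x : Site (F.P K) 0, ∑ μ : Fin (F.P K).d, A x μ
        + (((eta F n K)⁻¹) ^ 2) ^ 2 * 9 * (2 * k * a ^ 2) * ∑ x : Site (F.P K) 0, ∑ μ : Fin (F.P K).d, B x μ
        + (((eta F n K)⁻¹) ^ 2) ^ 2 * 9 * (3 * k * a₂ ^ 2) * (3 * ∑ x : Site (F.P K) 0, C x) := by
    simp only [Finset.sum_add_distrib, ← Finset.mul_sum, Finset.sum_const, Finset.card_univ, card_dir_eq_three, nsmul_eq_mul]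
  -- the `D*` family sum equals the `D` family sum (unitarity + shift of the site sum)
  have hstar : ∀ (c : ι) (μ : Fin (F.P K).d), ∑ x : Site (F.P K) 0, ∑ j : Fin 2, ∑ k' : Fin 2, ‖(covDstar (torusT (F.P K) 0) U μ (l c) x) j k'‖ ^ 2
      = ∑ x : Site (F.P K) 0, ∑ j : Fin 2, ∑ k' : Fin 2, ‖(covD (torusT (F.P K) 0) U μ (l c) x) j k'‖ ^ 2 := by
    intro c μ
    have e : ∀ x : Site (F.P K) 0, ∑ j : Fin 2, ∑ k' : Fin 2, ‖(covDstar (torusT (F.P K) 0) U μ (l c) x) j k'‖ ^ 2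
        = ∑ j : Fin 2, ∑ k' : Fin 2, ‖(covD (torusT (F.P K) 0) U μ (l c) (x.unshift μ)) j k'‖ ^ 2 := fun x => by
      rw [hs_covDstar_eq (P := F.P K) (i := 0) (U := U) hUu μ (l c) x, torusT_symm_apply]
    simp only [e]
    exact sum_unshift (P := F.P K) μ (fun x => ∑ j : Fin 2, ∑ k' : Fin 2, ‖(covD (torusT (F.P K) 0) U μ (l c) x) j k'‖ ^ 2)
  -- the family sums in the order `Σ_c Σ_x Σ_μ`
  have hAsum : ∑ x : Site (F.P K) 0, ∑ μ : Fin (F.P K).d, A x μ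
      = ∑ c : ι, ∑ x : Site (F.P K) 0, ∑ μ : Fin (F.P K).d, ∑ j : Fin 2, ∑ k' : Fin 2, ‖(covD (torusT (F.P K) 0) U μ (l c) x) j k'‖ ^ 2 := by
    simp only [hA]
    calc ∑ x : Site (F.P K) 0, ∑ μ : Fin (F.P K).d, ∑ c : ι, ∑ j : Fin 2, ∑ k' : Fin 2, ‖(covDstar (torusT (F.P K) 0) U μ (l c) x) j k'‖ ^ 2
        = ∑ μ : Fin (F.P K).d, ∑ x : Site (F.P K) 0, ∑ c : ι, ∑ j : Fin 2, ∑ k' : Fin 2, ‖(covDstar (torusT (F.P K) 0) U μ (l c) x) j k'‖ ^ 2 :=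
          Finset.sum_comm
      _ = ∑ μ : Fin (F.P K).d, ∑ c : ι, ∑ x : Site (F.P K) 0, ∑ j : Fin 2, ∑ k' : Fin 2, ‖(covDstar (torusT (F.P K) 0) U μ (l c) x) j k'‖ ^ 2 :=
          Finset.sum_congr rfl fun μ _ => Finset.sum_comm
      _ = ∑ μ : Fin (F.P K).d, ∑ c : ι, ∑ x : Site (F.P K) 0, ∑ j : Fin 2, ∑ k' : Fin 2, ‖(covD (torusT (F.P K) 0) U μ (l c) x) j k'‖ ^ 2 :=
          Finset.sum_congr rfl fun μ _ => Finset.sum_congr rfl fun c _ => hstar c μ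
      _ = ∑ c : ι, ∑ μ : Fin (F.P K).d, ∑ x : Site (F.P K) 0, ∑ j : Fin 2, ∑ k' : Fin 2, ‖(covD (torusT (F.P K) 0) U μ (l c) x) j k'‖ ^ 2 :=
          Finset.sum_comm
      _ = _ := Finset.sum_congr rfl fun c _ => Finset.sum_comm
  have hBsum : ∑ x : Site (F.P K) 0, ∑ μ : Fin (F.P K).d, B x μ
      = ∑ c : ι, ∑ x : Site (F.P K) 0, ∑ μ : Fin (F.P K).d, ∑ j : Fin 2, ∑ k' : Fin 2, ‖(covD (torusT (F.P K) 0) U μ (l c) x) j k'‖ ^ 2 := by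
    simp only [hB]
    calc ∑ x : Site (F.P K) 0, ∑ μ : Fin (F.P K).d, ∑ c : ι, ∑ j : Fin 2, ∑ k' : Fin 2, ‖(covD (torusT (F.P K) 0) U μ (l c) x) j k'‖ ^ 2
        = ∑ x : Site (F.P K) 0, ∑ c : ι, ∑ μ : Fin (F.P K).d, ∑ j : Fin 2, ∑ k' : Fin 2, ‖(covD (torusT (F.P K) 0) U μ (l c) x) j k'‖ ^ 2 :=
          Finset.sum_congr rfl fun x _ => Finset.sum_comm
      _ = _ := Finset.sum_comm
  have hCsum : ∑ x : Site (F.P K) 0, C x = ∑ c : ι, ∑ x : Site (F.P K) 0, ∑ j : Fin 2, ∑ k' : Fin 2, ‖l c x j k'‖ ^ 2 := by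
    simp only [hC]; exact Finset.sum_comm
  -- assemble
  rw [hsplit, hAsum, hBsum, hCsum] at hsum
  refine (mul_le_mul_of_nonneg_left hsum hc.le).trans (le_of_eq ?_)
  simp only [← Finset.mul_sum]
  ring

end Summed

end Summit.QuantumFields.YangMills.Theorems.Prop7Lane2CutoffFamilyRows

end
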